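import Summits.QuantumFields.YangMills.Theorems.BalabanLadderUVSeamRecCeilingsWindowCellLawsThreshold
import Summits.QuantumFields.YangMills.Theorems.BalabanLadderUVSeamRecCeilingsDLRPeelingResponseMoments
import Summits.QuantumFields.YangMills.Theorems.BalabanLadderUVSeamRecClassicalResponseGlue
import HarnessLib

/-!
# Crux `UVSeamRec` (stmt-QuantumFields-20043), v5(α) stub `stub_responseMomentsOdd6` (RM): the (β-cl) glue with the large-field half in
# ONE-BOX currency — (split-cl) + (GD) + UNIFORM CONDITIONAL RARITY (UCR) ⇒ `ResponseMomentsOdd6SU2`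

Helper file (`--supports stmt-QuantumFields-20043`) of the width-lever seat `ym-20043-ceilings-p2` (lane B, gen 6); the twin of g3's seam-aware glue
p555649 `TemperedResponse.responseMomentsOdd6SU2_of_splitCl_gaussianDomination_windowCellLaws` (and of the LEAD's v6(β-cl) glue p548409) in which
the large-field input is NOT a torus-side product law (window cell laws on every odd torus) but the ONE-BOX statement (UCR): for every level `k ≥ 1`,
block index, orientation and EVERY exterior configuration, the cube-kernel probability of N20's large-field event in the collar cube of side
`(2m+1)b^k` is at most `w(β,k)`, with `Σ_k w^{1/(16K)} ≤ D`, `K = 256(2m+4)⁴`.  The torus, the seam and the divisibility of `2L+1` have left the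
hypothesis: DLR peeling (this seat's `…CeilingsDLRPeeling*`) turns (UCR) into the window cell laws on every odd torus holding the collar cube, and
g3's engine (asked only of shell subfamilies) does the rest.

* `responseMomentsOdd6SU2_of_splitCl_gaussianDomination_uniformConditionalRarity` — hypotheses: `SplitCl`, `GaussianDominationSU2`, floor
  `0 < ε₀ ≤ ε β 0`, collar `b ≤ m ≤ 7`, (UCR) with weights `w ∈ [0,1]` and the root budget `D`; conclusion `ResponseMomentsDefs.ResponseMomentsOdd6SU2`.
HONEST FRAMING: composition; (split-cl), (GD), (UCR) are OPEN renormalisation-group statements ((UCR): Bałaban's R-operation currency in a box with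
Dirichlet data, unprinted; classically inconsistent below flat penetration); nothing of E0′; not a gap, not Clay.  References: folklore.
-/

set_option autoImplicit false

noncomputable section

open MeasureTheory Filter Topology Finset
open Literature.Probability.LatticeModels
open Literature.MathematicalPhysics.QuantumFieldTheory (GaugeConfig LatticeRep)
open Literature.MathematicalPhysics.QuantumLattice
open Summit.QuantumFields.YangMills.Cruxes.OSLegsFromFemtoAndGap.DlrCollarTransfer
open Summit.QuantumFields.YangMills.Cruxes.UVSeamRec.ClassicalResponse
open Summit.QuantumFields.YangMills.Cruxes.UVSeamRec.PolymerData
open Summit.QuantumFields.YangMills.Cruxes.UVSeamRec.TemperedResponse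
open Summit.QuantumFields.YangMills.Theorems.OddTorusChessboard (Orient)

namespace Summit.QuantumFields.YangMills.Cruxes.UVSeamRec.DLRPeeling

/-- **THE v8(β-cl-UCR) GLUE: (split-cl) + (GD) + ONE-BOX UNIFORM CONDITIONAL RARITY ⇒ the registered stub body `ResponseMomentsOdd6SU2`.**
Tempering data `𝔟, ε, kmax`, constants `C_s > 0`, `C₁ > 0`, `A₀ ≥ 0`, `ℓ₁ > 0`, bounded reference values `p`, with the LEAD's (split-cl)
`SplitCl 𝔟 ε kmax C_s C₁ A₀ β₁ ℓ₁ p` and (GD) `GaussianDominationSU2`; a level-`0` threshold floor `0 < ε₀ ≤ ε β 0`; and lane B's ONE-BOX large-field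
input: a collar `b ≤ m ≤ 7`, weights `w β k ∈ [0,1]` with (UCR) for `β ≥ β₁`, `k ≥ 1` — for every block index `y`, orientation `μ<ν` and EVERY
exterior `η`, `kerE^η_{(b^k(y−m),(2m+1)b^k)}(1_{largeFieldEvent 𝔟 (ε β k) (k,y,μ,ν)}) ≤ w β k` — and the budget
`Σ_{1≤k≤kmax β R} (w β k)^{1/(16·256(2m+4)⁴)} ≤ D` (`β ≥ β₁`).  THEN `ResponseMomentsOdd6SU2`.  Composition: the LEAD's constants and
Hubbard–Stratonovich exactly as in g3's `responseMomentsOdd6SU2_of_splitCl_gaussianDomination_windowCellLaws` (p555649), then this seat's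
`responseMoments_of_quadratic_and_uniformConditionalRarity` (DLR peeling, no RP, no divisibility) with the level-`0` floor turned into the
eventual bound `Δ₀ = 1` (`levelZero_activity_eventually_le`).  So a v8 along (β-cl) may register {(split-cl), (GD), (UCR)} — the third a statement
about ONE b-adic box with Dirichlet data — and close `stub_responseMomentsOdd6` by `exact` this.  HONEST FRAMING: composition; all three inputs
are OPEN renormalisation-group statements ((UCR) classically needs thresholds above the flat-penetration value `1 − cos(π²/(2m+1)²) ≈ π⁴/(2(2m+1)⁴)`); nothing of E0′. [folklore] -/
theorem responseMomentsOdd6SU2_of_splitCl_gaussianDomination_uniformConditionalRarity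
    (𝔟 : BlockSize) (ε : ℝ → ℕ → ℝ) (kmax : ℝ → ℕ → ℕ) {C_s C₁ A₀ P₀ β₁ ℓ₁ D ε₀ : ℝ} {p : Fin 4 × Fin 4 → ℝ → ℝ}
    (hCs : 0 < C_s) (hC₁ : 0 < C₁) (hA₀ : 0 ≤ A₀) (hℓ₁ : 0 < ℓ₁) (hp : ∀ q β, |p q β| ≤ P₀)
    (hsplit : SplitCl 𝔟 ε kmax C_s C₁ A₀ β₁ ℓ₁ p) (hGD : GaussianDominationSU2)
    (hε₀ : 0 < ε₀) (hε : ∀ β, ε₀ ≤ ε β 0)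
    (m : ℕ) (hm : 𝔟.b ≤ m) (hm7 : m ≤ 7) (w : ℝ → ℕ → ℝ) (hw0 : ∀ β k, 0 ≤ w β k) (hw1 : ∀ β k, w β k ≤ 1)
    (hUCR : ∀ β : ℝ, β₁ ≤ β → ∀ k : ℕ, 1 ≤ k → ∀ (y : Fin 4 → ℤ) (μ ν : Fin 4) (h : μ < ν)
      (η : LGConfig 4 (Matrix.specialUnitaryGroup (Fin 2) ℂ)),
      kerE (Matrix.specialUnitaryGroup (Fin 2) ℂ) (fundamentalLatticeRep 2) β (fun i => (𝔟.b : ℤ) ^ k * (y i - m)) ((2 * m + 1) * 𝔟.b ^ k) η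
        ((largeFieldEvent (N := 2) 𝔟 (ε β k) ⟨k, y, μ, ν, h⟩).indicator fun _ => (1 : ℝ)) ≤ w β k)
    (hD : ∀ β : ℝ, β₁ ≤ β → ∀ R : ℕ,
      ∑ k ∈ (Finset.range (kmax β R + 1)).filter (fun k => 1 ≤ k), w β k ^ ((1 : ℝ) / (16 * (256 * (2 * m + 4) ^ 4))) ≤ D) :
    ResponseMomentsDefs.ResponseMomentsOdd6SU2 := by
  obtain ⟨m₁, v₁, β₁', ℓ₁', hℓ₁', hEM⟩ := hGD
  -- constants (as in the LEAD's glue)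
  set C : ℝ := max C_s (4 * v₁ + 1) with hCdef
  have hCsC : C_s ≤ C := le_max_left _ _
  have hCpos : 0 < C := hCs.trans_le hCsC
  have h4v : 4 * (v₁ / C) < 1 := by
    rw [mul_div_assoc', div_lt_one hCpos]
    have : 4 * v₁ + 1 ≤ C := le_max_right _ _
    linarith
  set β₀ : ℝ := max (max β₁ β₁') 0 with hβ₀
  have hβ₀₁ : β₁ ≤ β₀ := (le_max_left _ _).trans (le_max_left _ _)
  have hβ₀₁' : β₁' ≤ β₀ := (le_max_right _ _).trans (le_max_left _ _)
  have hβ₀0 : 0 ≤ β₀ := le_max_right _ _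
  set ℓ₀ : ℝ := min ℓ₁ ℓ₁' with hℓ₀
  have hℓ₀pos : 0 < ℓ₀ := lt_min hℓ₁ hℓ₁'
  set rF : LatticeRep (Matrix.specialUnitaryGroup (Fin 2) ℂ) := fundamentalLatticeRep 2 with hrF
  -- rescaled laws
  have hsplitC := splitCl_rescale hCs hCsC hA₀ hsplit
  have hEMC := emLin_rescale hCpos hEM
  -- the quadratic carrier and its linear statistic
  set Q : ℝ → ℕ → Fin 4 × Fin 4 → (Fin 4 → ℤ) → LGConfig 4 (Matrix.specialUnitaryGroup (Fin 2) ℂ) → ℝ :=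
    fun β R q x η => carrierCl rF C 1 β R q x η with hQdef
  set ℓ : ℝ → ℕ → Fin 4 × Fin 4 → (Fin 4 → ℤ) → LGConfig 4 (Matrix.specialUnitaryGroup (Fin 2) ℂ) → ℝ :=
    fun β R q x η => Real.sqrt (carrierCl rF C 1 β R q x η) with hℓdef
  have hℓm : ∀ β R q x, Measurable (ℓ β R q x) := fun β R q x => (measurable_carrierCl (r := rF) C 1 β R q x).sqrt
  have hℓb : ∀ β R q x η, |ℓ β R q x η| ≤ Real.sqrt (|β| * (R : ℝ) ^ 4 / |C| * (2 * rF.N)) := fun β R q x η => by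
    simp only [hℓdef]
    rw [abs_of_nonneg (Real.sqrt_nonneg _)]
    exact Real.sqrt_le_sqrt ((le_abs_self _).trans (abs_carrierCl_le (r := rF) C one_pos β R q x η))
  -- (EM_Q) for `1·ℓ²` from the rescaled (EM_lin), restricted to β ≥ β₀ and R·uRec β ≤ ℓ₀
  have hEMQ1 := emQ_of_subGaussianLinear rF Transport.uRec (β₁ := β₀) (ℓ₁ := ℓ₀) ℓ
    (fun β R => Real.sqrt (|β| * (R : ℝ) ^ 4 / |C| * (2 * rF.N))) hℓm hℓb (m := m₁ / Real.sqrt C) (v := v₁ / C) (lam := 1)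
    zero_le_one (by linarith)
    (fun β hβ L n q x R hq hR hRa hL hsep T t =>
      hEMC β (hβ₀₁'.trans hβ) L n q x R hq hR (hRa.trans (min_le_right _ _)) hL hsep T t)
  -- convert `1·(√Q)²` to `Q` (β ≥ β₀ ≥ 0)
  have hEMQ : ∀ β : ℝ, β₀ ≤ β → ∀ (L n : ℕ) (q : Fin n → Fin 4 × Fin 4) (x : Fin n → (Fin 4 → ℤ)) (R : ℕ),
      (∀ i, (q i).1 < (q i).2) → 1 ≤ R → (R : ℝ) * Transport.uRec β ≤ ℓ₀ → 4 * R + 8 ≤ L →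
      (∀ i j : Fin n, i ≠ j → ∃ k : Fin 4,
        (2 * (R : ℤ) + 4) ≤ |((((x i k - x j k : ℤ) : ZMod (2 * L + 1))).valMinAbs : ℤ)|) →
      ∀ T : Finset (Fin n),
        torusE (Matrix.specialUnitaryGroup (Fin 2) ℂ) rF β L
          (fun U => Real.exp (((2 : ℕ) : ℝ) * ∑ i ∈ T, Q β R (q i) (x i) U)) ≤
          Real.exp (Real.log (2 * (Real.sqrt (1 / (1 - 4 * (1 * (v₁ / C)))) *
            Real.exp (2 * 1 * (m₁ / Real.sqrt C) ^ 2 / (1 - 4 * (1 * (v₁ / C)))))) * T.card) := by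
    intro β hβ L n q x R hq hR hRa hL hsep T
    have h := hEMQ1 β hβ L n q x R hq hR hRa hL hsep T
    have e : (fun U : LGConfig 4 (Matrix.specialUnitaryGroup (Fin 2) ℂ) =>
        Real.exp (((2 : ℕ) : ℝ) * ∑ i ∈ T, Q β R (q i) (x i) U)) =
        (fun U => Real.exp (((2 : ℕ) : ℝ) * ∑ i ∈ T, 1 * (ℓ β R (q i) (x i) U) ^ 2)) := by
      funext U
      refine congrArg Real.exp (congrArg _ (Finset.sum_congr rfl fun i _ => ?_))
      simp only [hQdef, hℓdef]
      rw [one_mul, Real.sq_sqrt (carrierCl_nonneg (r := rF) hCpos one_pos (hβ₀0.trans hβ) R (q i) (x i) U)]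
    rw [e]
    exact h
  -- (RM) body from the (UCR) button (threshold floor at level 0 gives the eventual bound Δ₀ := 1)
  obtain ⟨β₁'', hRM⟩ := responseMoments_of_quadratic_and_uniformConditionalRarity (N := 2) Transport.uRec 𝔟 m hm hm7 ε kmax
    (C₁ := C₁ * C / C_s) (β₁ := β₀) (ℓ₁ := ℓ₀) (A₀ := A₀) (D := D) (Δ₀ := 1) (p := p) Q
    (fun β R _ _ => |β| * (R : ℝ) ^ 4 / |C| * (2 * rF.N))
    (fun β R q x => measurable_carrierCl (r := rF) C 1 β R q x)
    (fun β R q x η => abs_carrierCl_le (r := rF) C one_pos β R q x η)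
    (fun β hβ R hR hRa q x hq η => hsplitC β (hβ₀₁.trans hβ) R hR (hRa.trans (min_le_left _ _)) q x hq η)
    hEMQ (fun K₀ D₁ => levelZero_activity_eventually_le (N := 2) two_pos hε₀ one_pos ε hε K₀ D₁) w hw0 hw1
    (fun β hβ k hk y μ ν hμν η => hUCR β (hβ₀₁.trans hβ) k hk y μ ν hμν η)
    (fun β hβ R => hD β (hβ₀₁.trans hβ) R)
  exact ⟨Transport.uRec, 1, C₁ * C / C_s, _, β₁'', ℓ₀, P₀, p, one_pos,
    Filter.Eventually.of_forall fun β => by rw [one_mul], hℓ₀pos, by positivity, hp, hRM⟩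

end Summit.QuantumFields.YangMills.Cruxes.UVSeamRec.DLRPeeling

end
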